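import Literature.NumberTheory.EllipticCurves.Rank1Residual.Typed.PAdicCertificateSurjective
import Literature.NumberTheory.EllipticCurves.Wuthrich2014.ThreeAdicImage
import HarnessLib

/-!
# X11 at `p = 3` (and any odd `p`) with surjective image: Wuthrich's Lemma 20 supplies the `3`-adic surjectivity the Kato divisibility needs (cell `b2b-bsdres`)

HONEST FRAMING (run/shared/lean/b2b/bsd-rank1-residual/, verbatim): the goal of the cell is to
DELETE the COMBINATION-SHAPED residual classes for ALL analytic-rank `≤ 1` elliptic curves over `ℚ`
— "full BSD formula for every rank `≤ 1` curve in class C" assembled STRICTLY from published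
theorems — so that the rank-`≤ 1` remainder becomes exactly the CONSTRUCTION-SHAPED classes, which
are TYPED (missing-input `Prop`s), NOT attempted. This is not "finishing BSD". X11 ∧ `r = 1` ∧
`p = 3` (`X11Three`) is CONSTRUCTION-SHAPED and STAYS so: this file is a per-curve certificate lever.

Theorems only (no definition, no new named fact; literature seat gen 5). The X11 wrappers of
`Typed/PAdicCertificateSurjective.lean` (p181404) take `5 ≤ p` because they feed the census
predicate `Surj W p` (mod `p`) through Serre's lifting lemma (`p ≥ 5`). The engine-level theorems
there (`noPTorsion_of_katoSurj_{split,nonsplit}_of_leadingTerm_certificate`) only need `p ≠ 2` and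
the `p`-ADIC surjectivity `∀ n, ρ̄_{E,p^n}` onto — which at `p = 3` is supplied, for a curve that is
NOT ADDITIVE at `3`, by the tree's named fact `Wuthrich2014.lemma20_surjective_threeAdic_of_semistable`
(C. Wuthrich, Doc. Math. 19 (2014), Lemma 20, p. 400, used in the proof of Cor. 19 exactly for this:
"Finally for `p = 3` we use the following lemma to exclude that `ρ_p` is not surjective"; the
exotic `3`-adic images of Elkies all have additive reduction at `3`). Hence:

* `X11.bsdp_of_katoSurj_{split,nonsplit}_of_surjective_pow` — the X11 wrappers at ANY odd `p` with
  the `p`-adic surjectivity as the binder (`ClassX11 W p`; no `Ram`, no semistability);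
* `surjective_pow_three_of_mult` — at a multiplicative prime `3`, `Surj W 3` ⇒ `∀ n, ρ̄_{E,3^n}`
  onto (Lemma 20);
* `X11.bsdp_of_katoSurj_{split,nonsplit}_three` — X11 at `p = 3`, `ρ̄_{E,3}` surjective,
  analytic rank `≤ 1`, `3 ∤ #Ш_an`: `BSD(E,3)` from PUBLISHED facts (F35 `hK`, Lemma 20 `h20`,
  Prop. 21 `hW`, GZK, modularity) plus ONE leading-term clause (Jones 1989, hypothesis `hLT`) plus
  the per-curve `3`-adic certificate.

Census context (RESIDUAL-CASES.md §a.2 row X11b sub-tags, N < 10⁴; numbers the lane's): the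
rank-one `p = 3` multiplicative irreducible pairs are 214 = 93 `sst ∧ ram` + 111 `¬sst ∧ ram` +
10 `¬sst ∧ ¬ram`. The divisibility at `p = 3` is ALREADY in the tree for the first two groups —
Skinner 2016 Thm. A has `p ≥ 3` (`X11.bsdp_of_thmA_{split,nonsplit}_of_leadingTerm_certificate`,
p181066, binder `3 ≤ p`) and Wuthrich Cor. 19 has `p` odd (`Typed/PAdicCertificateSemistable.lean`,
p179945, binder `p ≠ 2`) —; this file covers the third group when `ρ̄_{E,3}` is surjective. So the
whole X11 ∧ `r = 1` ∧ `p = 3` population has the per-curve shape "PUBLISHED divisibility + ONE typed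
input (Jones's leading-term clause) + per-curve certificate", EXCEPT pairs at `3` whose image is
irreducible, non-surjective, without a (ram) prime and non-semistable (none is claimed to exist or
not to exist here). CAVEAT recorded for the lane: Jones 1989 is not held (acq-07893); whether its
leading-term theorem allows `p = 3` must be checked before any `p = 3` certificate is booked. Per
curve; NOT a class theorem; no verdict or label changed.

References: [Wuthrich2014] Lemma 20 (p. 399), Cor. 19 (p. 398; proof p. 399), Thm. 3 and §1 (p. 383);
[Skinner2016PacificMC] Thm. A ("Let `p ≥ 3`"); [Miller2011LMS] Prop. 7.6.
-/

set_option autoImplicit false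

noncomputable section

open scoped Classical MatrixGroups ModularForm

open CongruenceSubgroup WeierstrassCurve Literature.NumberTheory.EllipticCurves
  Literature.NumberTheory.EllipticCurves.ModularForms
  Literature.NumberTheory.EllipticCurves.Rank1Residual
  Literature.NumberTheory.EllipticCurves.Wuthrich2014

namespace Literature.NumberTheory.EllipticCurves.Rank1Residual.Typed

/-! ### X11 wrappers at any odd `p`, `p`-adic surjectivity as the binder -/

/-- **X11, split multiplicative odd `p`, `ρ_{E,p^∞}` surjective (`∀ n`, `ρ̄_{E,p^n}` onto), analytic
rank `≤ 1`, `p ∤ #Ш_an`: `BSD(E,p)`** from F35 (`hK`), Prop. 21 (`hW`), GZK, modularity, plus ONE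
leading-term clause (Jones 1989, hypothesis) plus the per-curve certificate. No `Ram`, no
semistability, no `5 ≤ p`. Per curve; NOT a deletion of X11.
[cite: Wuthrich2014, Cor. 19 proof, first case (p. 399); Prop. 21 (p. 400)]
[cite: Miller2011LMS, Prop. 7.6] -/
theorem X11.bsdp_of_katoSurj_split_of_surjective_pow
    (hK : kato_charIdeal_dvd_multiplicative_of_surjective)
    (hW : Wuthrich2014.sha_dvd_analyticSha) (hGZK : rank_eq_analyticRank_of_analyticRank_le_one)
    (hmod : hasEntireLFunction_rat)
    (W : WeierstrassCurve ℚ) [W.IsElliptic] [W.IsGloballyMinimal] (p : ℕ) [Fact p.Prime]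
    {κ : ZpExtension ℚ p} {γ : Field.absoluteGaloisGroup ℚ} {N : ℕ} [NeZero N]
    {f : CuspForm (Gamma0 N) 2} (hp : p ≠ 2) (hr : W.analyticRank ≤ 1) (hX : ClassX11 W p)
    (hρ : ∀ n : ℕ, W.HasSurjectiveModNGaloisRep (p ^ n : ℕ))
    (hsplit : W.HasSplitMultiplicativeReductionAtPrime p)
    (hκ : κ.IsCyclotomic) (hγ : κ.IsTopGenerator γ) (hγ' : IsCyclotomicVariable p γ)
    (hf : IsNewformOf W f) (D : W.SelmerDualData κ γ) (ϖ : ℚ) (hϖ0 : ϖ ≠ 0)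
    (hϖ : (ϖ : ℝ) * W.realPeriodRat = plusPeriod f)
    (L : PowerSeries ℚ_[p]) (hL : IsSplitMultPAdicLFunctionOf f p L)
    (hordL : L.order = (W.mordellWeilRank + 1 : ℕ)) (A B R : ℚ_[p]) (hA0 : A ≠ 0)
    (hLT : ∀ fE : IwasawaAlgebra p, D.charIdeal = Ideal.span {fE} →
      fE.order = (W.mordellWeilRank : ℕ) → Finite (AddCommGroup.primaryComponent W.sha p) ∧ R ≠ 0 ∧
        ∃ u : ℤ_[p]ˣ, ((PowerSeries.coeff W.mordellWeilRank fE : ℤ_[p]) : ℚ_[p]) * B =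
          ((u : ℤ_[p]) : ℚ_[p]) *
            (A * R * (Nat.card (AddCommGroup.primaryComponent W.sha p) : ℚ_[p])))
    (hcert : (((ϖ : ℚ) : ℚ_[p]) * PowerSeries.coeff (W.mordellWeilRank + 1) L * B).valuation =
      (A * R).valuation)
    {s : ℚ} (hs : shaAn W = (s : ℂ)) (hv : padicValRat p s = 0) : BSDp W p :=
  X11.bsdp_of_shaAn_unit_of_noPTorsion W p hW hGZK hmod hp hr hX hs hv
    (noPTorsion_of_katoSurj_split_of_leadingTerm_certificate hK W p hp hsplit hρ hκ hγ hγ' hf D ϖ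
      hϖ0 hϖ L hL hordL A B R hA0 hLT hcert)

/-- **X11, NON-split multiplicative odd `p`, `ρ_{E,p^∞}` surjective, analytic rank `≤ 1`,
`p ∤ #Ш_an`: `BSD(E,p)`** as above from the non-split clause. Per curve; NOT a deletion of X11.
[cite: Wuthrich2014, Thm. 3 and §1 (p. 383); Prop. 21 (p. 400)] [cite: Miller2011LMS, Prop. 7.6] -/
theorem X11.bsdp_of_katoSurj_nonsplit_of_surjective_pow
    (hK : kato_charIdeal_dvd_multiplicative_of_surjective)
    (hW : Wuthrich2014.sha_dvd_analyticSha) (hGZK : rank_eq_analyticRank_of_analyticRank_le_one)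
    (hmod : hasEntireLFunction_rat)
    (W : WeierstrassCurve ℚ) [W.IsElliptic] [W.IsGloballyMinimal] (p : ℕ) [Fact p.Prime]
    {κ : ZpExtension ℚ p} {γ : Field.absoluteGaloisGroup ℚ} {N : ℕ} [NeZero N]
    {f : CuspForm (Gamma0 N) 2} (hp : p ≠ 2) (hr : W.analyticRank ≤ 1) (hX : ClassX11 W p)
    (hρ : ∀ n : ℕ, W.HasSurjectiveModNGaloisRep (p ^ n : ℕ))
    (hns : ¬ W.HasSplitMultiplicativeReductionAtPrime p)
    (hκ : κ.IsCyclotomic) (hγ : κ.IsTopGenerator γ) (hγ' : IsCyclotomicVariable p γ)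
    (hf : IsNewformOf W f) (D : W.SelmerDualData κ γ) (ϖ : ℚ) (hϖ0 : ϖ ≠ 0)
    (hϖ : (ϖ : ℝ) * W.realPeriodRat = plusPeriod f)
    (L : PowerSeries ℚ_[p]) (hL : IsMultPAdicLFunctionOf f p (-1) L)
    (hordL : L.order = (W.mordellWeilRank : ℕ)) (A B R : ℚ_[p]) (hA0 : A ≠ 0)
    (hLT : ∀ fE : IwasawaAlgebra p, D.charIdeal = Ideal.span {fE} →
      fE.order = (W.mordellWeilRank : ℕ) → Finite (AddCommGroup.primaryComponent W.sha p) ∧ R ≠ 0 ∧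
        ∃ u : ℤ_[p]ˣ, ((PowerSeries.coeff W.mordellWeilRank fE : ℤ_[p]) : ℚ_[p]) * B =
          ((u : ℤ_[p]) : ℚ_[p]) *
            (A * R * (Nat.card (AddCommGroup.primaryComponent W.sha p) : ℚ_[p])))
    (hcert : (((ϖ : ℚ) : ℚ_[p]) * PowerSeries.coeff W.mordellWeilRank L * B).valuation =
      (A * R).valuation)
    {s : ℚ} (hs : shaAn W = (s : ℂ)) (hv : padicValRat p s = 0) : BSDp W p :=
  X11.bsdp_of_shaAn_unit_of_noPTorsion W p hW hGZK hmod hp hr hX hs hv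
    (noPTorsion_of_katoSurj_nonsplit_of_leadingTerm_certificate hK W p hp hX.1 hns hρ hκ hγ hγ' hf D
      ϖ hϖ0 hϖ L hL hordL A B R hA0 hLT hcert)

/-! ### `p = 3`: Wuthrich's Lemma 20 gives the `3`-adic surjectivity at a multiplicative prime -/

/-- **Lemma 20 at a multiplicative prime `3`**: if `E` has multiplicative reduction at `3` and
`ρ̄_{E,3}` is surjective then every `ρ̄_{E,3^n}` is surjective (named fact
`lemma20_surjective_threeAdic_of_semistable`, whose hypothesis "semi-stable at `3`" is LOCAL: good or
multiplicative reduction at `3`). [cite: Wuthrich2014, Lemma 20 (p. 399)] -/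
theorem surjective_pow_three_of_mult (h20 : lemma20_surjective_threeAdic_of_semistable)
    (W : WeierstrassCurve ℚ) [W.IsElliptic] [Fact (3 : ℕ).Prime]
    (hmult : W.HasMultiplicativeReductionAtPrime 3) (hρ : W.HasSurjectiveModNGaloisRep 3) :
    ∀ n : ℕ, W.HasSurjectiveModNGaloisRep (3 ^ n : ℕ) :=
  h20 W (Or.inr hmult) hρ

/-- **X11 at `p = 3`, split multiplicative, `ρ̄_{E,3}` surjective, analytic rank `≤ 1`,
`3 ∤ #Ш_an`: `BSD(E,3)`** from PUBLISHED facts (F35 `hK`, Lemma 20 `h20`, Prop. 21 `hW`, GZK,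
modularity) plus ONE leading-term clause (Jones 1989 — hypothesis `hLT`; whether Jones's theorem
allows `p = 3` is NOT checked here, text not held) plus the per-curve `3`-adic certificate. This is the
shape of the `¬sst ∧ ¬ram` rank-one pairs at `p = 3` with surjective `ρ̄_{E,3}` (the (ram) ones have
Skinner Thm. A, `p ≥ 3`; the semistable ones Cor. 19, `p` odd). Per curve; X11 ∧ `r = 1` ∧ `p = 3`
stays CONSTRUCTION-SHAPED. [cite: Wuthrich2014, Lemma 20 (p. 399); Cor. 19 proof (p. 399)]
[cite: Miller2011LMS, Prop. 7.6] -/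
theorem X11.bsdp_of_katoSurj_split_three
    (hK : kato_charIdeal_dvd_multiplicative_of_surjective)
    (h20 : lemma20_surjective_threeAdic_of_semistable)
    (hW : Wuthrich2014.sha_dvd_analyticSha) (hGZK : rank_eq_analyticRank_of_analyticRank_le_one)
    (hmod : hasEntireLFunction_rat)
    (W : WeierstrassCurve ℚ) [W.IsElliptic] [W.IsGloballyMinimal] [Fact (3 : ℕ).Prime]
    {κ : ZpExtension ℚ 3} {γ : Field.absoluteGaloisGroup ℚ} {N : ℕ} [NeZero N]
    {f : CuspForm (Gamma0 N) 2} (hr : W.analyticRank ≤ 1) (hX : ClassX11 W 3) (hρ : Surj W 3)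
    (hsplit : W.HasSplitMultiplicativeReductionAtPrime 3)
    (hκ : κ.IsCyclotomic) (hγ : κ.IsTopGenerator γ) (hγ' : IsCyclotomicVariable 3 γ)
    (hf : IsNewformOf W f) (D : W.SelmerDualData κ γ) (ϖ : ℚ) (hϖ0 : ϖ ≠ 0)
    (hϖ : (ϖ : ℝ) * W.realPeriodRat = plusPeriod f)
    (L : PowerSeries ℚ_[3]) (hL : IsSplitMultPAdicLFunctionOf f 3 L)
    (hordL : L.order = (W.mordellWeilRank + 1 : ℕ)) (A B R : ℚ_[3]) (hA0 : A ≠ 0)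
    (hLT : ∀ fE : IwasawaAlgebra 3, D.charIdeal = Ideal.span {fE} →
      fE.order = (W.mordellWeilRank : ℕ) → Finite (AddCommGroup.primaryComponent W.sha 3) ∧ R ≠ 0 ∧
        ∃ u : ℤ_[3]ˣ, ((PowerSeries.coeff W.mordellWeilRank fE : ℤ_[3]) : ℚ_[3]) * B =
          ((u : ℤ_[3]) : ℚ_[3]) *
            (A * R * (Nat.card (AddCommGroup.primaryComponent W.sha 3) : ℚ_[3])))
    (hcert : (((ϖ : ℚ) : ℚ_[3]) * PowerSeries.coeff (W.mordellWeilRank + 1) L * B).valuation =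
      (A * R).valuation)
    {s : ℚ} (hs : shaAn W = (s : ℂ)) (hv : padicValRat 3 s = 0) : BSDp W 3 :=
  X11.bsdp_of_katoSurj_split_of_surjective_pow hK hW hGZK hmod W 3 (by decide) hr hX
    (surjective_pow_three_of_mult h20 W hsplit.hasMultiplicativeReductionAtPrime hρ) hsplit hκ hγ hγ'
    hf D ϖ hϖ0 hϖ L hL hordL A B R hA0 hLT hcert hs hv

/-- **X11 at `p = 3`, NON-split multiplicative, `ρ̄_{E,3}` surjective, analytic rank `≤ 1`,
`3 ∤ #Ш_an`: `BSD(E,3)`** as above from the non-split clause. Per curve; no label change.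
[cite: Wuthrich2014, Lemma 20 (p. 399); Thm. 3 and §1 (p. 383)] [cite: Miller2011LMS, Prop. 7.6] -/
theorem X11.bsdp_of_katoSurj_nonsplit_three
    (hK : kato_charIdeal_dvd_multiplicative_of_surjective)
    (h20 : lemma20_surjective_threeAdic_of_semistable)
    (hW : Wuthrich2014.sha_dvd_analyticSha) (hGZK : rank_eq_analyticRank_of_analyticRank_le_one)
    (hmod : hasEntireLFunction_rat)
    (W : WeierstrassCurve ℚ) [W.IsElliptic] [W.IsGloballyMinimal] [Fact (3 : ℕ).Prime]
    {κ : ZpExtension ℚ 3} {γ : Field.absoluteGaloisGroup ℚ} {N : ℕ} [NeZero N]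
    {f : CuspForm (Gamma0 N) 2} (hr : W.analyticRank ≤ 1) (hX : ClassX11 W 3) (hρ : Surj W 3)
    (hns : ¬ W.HasSplitMultiplicativeReductionAtPrime 3)
    (hκ : κ.IsCyclotomic) (hγ : κ.IsTopGenerator γ) (hγ' : IsCyclotomicVariable 3 γ)
    (hf : IsNewformOf W f) (D : W.SelmerDualData κ γ) (ϖ : ℚ) (hϖ0 : ϖ ≠ 0)
    (hϖ : (ϖ : ℝ) * W.realPeriodRat = plusPeriod f)
    (L : PowerSeries ℚ_[3]) (hL : IsMultPAdicLFunctionOf f 3 (-1) L)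
    (hordL : L.order = (W.mordellWeilRank : ℕ)) (A B R : ℚ_[3]) (hA0 : A ≠ 0)
    (hLT : ∀ fE : IwasawaAlgebra 3, D.charIdeal = Ideal.span {fE} →
      fE.order = (W.mordellWeilRank : ℕ) → Finite (AddCommGroup.primaryComponent W.sha 3) ∧ R ≠ 0 ∧
        ∃ u : ℤ_[3]ˣ, ((PowerSeries.coeff W.mordellWeilRank fE : ℤ_[3]) : ℚ_[3]) * B =
          ((u : ℤ_[3]) : ℚ_[3]) *
            (A * R * (Nat.card (AddCommGroup.primaryComponent W.sha 3) : ℚ_[3])))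
    (hcert : (((ϖ : ℚ) : ℚ_[3]) * PowerSeries.coeff W.mordellWeilRank L * B).valuation =
      (A * R).valuation)
    {s : ℚ} (hs : shaAn W = (s : ℂ)) (hv : padicValRat 3 s = 0) : BSDp W 3 :=
  X11.bsdp_of_katoSurj_nonsplit_of_surjective_pow hK hW hGZK hmod W 3 (by decide) hr hX
    (surjective_pow_three_of_mult h20 W hX.1 hρ) hns hκ hγ hγ' hf D ϖ hϖ0 hϖ L hL hordL A B R
    hA0 hLT hcert hs hv

end Literature.NumberTheory.EllipticCurves.Rank1Residual.Typed

end
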